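import Summits.AtomisticToContinuum.FouriersLaw.Theses.HonestZwanzig
import Summits.AtomisticToContinuum.FouriersLaw.Theorems.OddSectorIrreversibilityOddDensityIsCorrectorAdjoint
import Summits.AtomisticToContinuum.FouriersLaw.Theorems.OddSectorIrreversibilityCorrectorTheorySmooth
import Summits.AtomisticToContinuum.FouriersLaw.Theorems.HonestZwanzigOrthogonalOhmG0PosDefAux2
import Literature.MathematicalPhysics.KineticTheory.LangevinChainHormander
import Literature.MathematicalPhysics.KineticTheory.LangevinChainNESSProofs
import Literature.Analysis.Hypoelliptic.HormanderProof

/-!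
# HonestZwanzig / OrthogonalOhm — stub F1b `PoissonSmooth` (line `Sketch`, skeleton v5): hypoelliptic upgrade

Support file for crux item `stmt-AtomisticToContinuum-12693` (`HonestZwanzig.OrthogonalOhm`, sub-problem
`FouriersLaw`), line `Sketch`, registered stub `stub_poissonSmooth`.

For the pinned anharmonic chain `P = pinnedChain ω₂ lam β γ` at equal bath temperatures `T > 0` with Gibbs measure
`μ = Z⁻¹ ρ dz`, `ρ = e^{-H/T}`, momentum reversal `Θ(q,p) = (q,-p)` and generator `L = L_{T,T}`: a measurable,
locally bounded `v` solving the Poisson equation WEAKLY in the time-reversed form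
`∫ (Lφ)·(v∘Θ) dμ = -∫ φ f dμ` (`φ ∈ C_c^∞`, `f` smooth and even in `p`) has a smooth modification `w` with
`L w = -f` POINTWISE and the same continuous bound.

* `exists_contDiff_ae_eq_of_weak` — Hörmander's theorem (`hormander1967_thm11_proof`, PROVED in the tree) for the
  Fokker–Planck operator `P* = X_L² + X_R² - Y + 2γ`, whose formal transpose on test functions is `L`
  (`hormanderTranspose_eq_generator`) and whose fields are bracket generating (`isBracketGenerating_hormanderFamily`,
  `V'' = 1 + 3βr² > 0`), applied to the distribution `(v∘Θ)ρ dz` with smooth image `-fρ`: `(v∘Θ)ρ = g` a.e., `g ∈ C^∞`;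
* `generator_rev_eq_of_weak` — for smooth `w` with `w∘Θ = v∘Θ` a.e., the adjoint identity
  `∫ (Lφ) k dμ = ∫ φ (L(k∘Θ))∘Θ dμ` (`pinnedChain_integral_generator_mul_gibbsMeasure_eq_reversal`) and the fundamental
  lemma of the calculus of variations give `(Lw)∘Θ + f = 0` a.e., hence everywhere (continuity), hence `Lw = -f`;
* `exists_smooth_modification` — assembly (`w := (g∘Θ)/ρ`), with the bound transported by continuity;
* `stub_poissonSmooth` — the registered closed signature (`f = u - m`, `u = ∑ ξ_x e_x`, bound `A e^{H/(8T)}`;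
  smoothness / evenness of `e_x` from `G0PosDef.contDiff_splitSite`, `pinnedChain_splitSite_nice`).
-/

noncomputable section

open MeasureTheory Filter Topology Set Function TopologicalSpace
open scoped ContDiff Distributions
open Literature.MathematicalPhysics.KineticTheory.HeatConduction
open Literature.Analysis.Distribution

namespace Summit.AtomisticToContinuum.FouriersLaw.Theorems.HonestZwanzig

namespace OrthogonalOhmLine.PoissonSmooth

variable {N : ℕ}

/-! ### Continuity upgrades of almost-everywhere statements on phase space -/

/-- A continuous function on phase space vanishing Lebesgue-a.e. vanishes everywhere. [folklore] -/
theorem eq_zero_of_ae {F : PhaseSpace N → ℝ} (hF : Continuous F)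
    (h : ∀ᵐ z ∂(volume : Measure (PhaseSpace N)), F z = 0) (z : PhaseSpace N) : F z = 0 := by
  haveI := isAddHaarMeasure_volume_phaseSpace N
  have h0 : F = fun _ => 0 := Measure.eq_of_ae_eq h hF continuous_const
  exact congrFun h0 z

/-! ### The setting -/

section Pinned

variable {ω₂ lam β γ : ℝ} {T : ℝ}

/-- `ρ = e^{-H/T}` is smooth for the pinned chain. [folklore] -/
theorem contDiff_gibbsDensity (ω₂ lam β γ : ℝ) (N : ℕ) (T : ℝ) :
    ContDiff ℝ ∞ ((pinnedChain ω₂ lam β γ).gibbsDensity N T) := by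
  change ContDiff ℝ ∞ fun x => Real.exp (-(pinnedChain ω₂ lam β γ).hamiltonian N x / T)
  exact Real.contDiff_exp.comp ((pinnedChain_contDiff_hamiltonian ω₂ lam β γ N).neg.div_const T)

/-- `ρ` is even in the momenta. [folklore] -/
theorem gibbsDensity_rev (ω₂ lam β γ : ℝ) (N : ℕ) (T : ℝ) (z : PhaseSpace N) :
    (pinnedChain ω₂ lam β γ).gibbsDensity N T (z.1, -z.2) = (pinnedChain ω₂ lam β γ).gibbsDensity N T z := by
  change Real.exp (-(pinnedChain ω₂ lam β γ).hamiltonian N (z.1, -z.2) / T) =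
    Real.exp (-(pinnedChain ω₂ lam β γ).hamiltonian N z / T)
  rw [(pinnedChain ω₂ lam β γ).hamiltonian_neg_momentum]

/-- Lebesgue measure is absolutely continuous with respect to the Gibbs measure (`ρ > 0` integrable). [folklore] -/
theorem volume_absolutelyContinuous_gibbsMeasure (hω : 0 < ω₂) (hl : 0 ≤ lam) (hβ : 0 ≤ β) (γ : ℝ) (N : ℕ)
    (hT : 0 < T) :
    (volume : Measure (PhaseSpace N)) ≪ (pinnedChain ω₂ lam β γ).gibbsMeasure N T := by
  rw [OscillatorChain.gibbsMeasure_eq]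
  exact absolutelyContinuous_tilted (f := fun x => -(pinnedChain ω₂ lam β γ).hamiltonian N x / T)
    (pinnedChain_integrable_gibbsDensity hω hl hβ γ N hT)

/-- `(v∘Θ)·ρ` is locally Lebesgue integrable when `v` is `μ`-measurable and `|v| ≤ B` with `B` continuous. [folklore] -/
theorem locallyIntegrable_rev_mul_gibbsDensity (hω : 0 < ω₂) (hl : 0 ≤ lam) (hβ : 0 ≤ β) (hT : 0 < T)
    {v B : PhaseSpace N → ℝ} (hB : Continuous B) (hvB : ∀ z, |v z| ≤ B z)
    (hv : AEStronglyMeasurable v ((pinnedChain ω₂ lam β γ).gibbsMeasure N T)) :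
    AEStronglyMeasurable (fun z : PhaseSpace N => v (z.1, -z.2)) (volume : Measure (PhaseSpace N)) ∧
    LocallyIntegrable (fun z : PhaseSpace N => v (z.1, -z.2) * (pinnedChain ω₂ lam β γ).gibbsDensity N T z)
      (volume : Measure (PhaseSpace N)) := by
  have hρc : Continuous ((pinnedChain ω₂ lam β γ).gibbsDensity N T) :=
    pinnedChain_continuous_gibbsDensity ω₂ lam β γ N T
  have hρpos : ∀ z, 0 < (pinnedChain ω₂ lam β γ).gibbsDensity N T z := fun z =>
    (pinnedChain ω₂ lam β γ).gibbsDensity_pos N T z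
  have hv_vol : AEStronglyMeasurable v (volume : Measure (PhaseSpace N)) :=
    hv.mono_ac (volume_absolutelyContinuous_gibbsMeasure hω hl hβ γ N hT)
  have hvΘ : AEStronglyMeasurable (fun z : PhaseSpace N => v (z.1, -z.2)) (volume : Measure (PhaseSpace N)) :=
    hv_vol.comp_quasiMeasurePreserving (measurePreserving_momentumReversal N).quasiMeasurePreserving
  refine ⟨hvΘ, ?_⟩
  refine (((hB.comp (continuous_fst.prodMk continuous_snd.neg)).mul hρc).locallyIntegrable
    (μ := volume)).mono (hvΘ.mul hρc.aestronglyMeasurable) (Eventually.of_forall fun z => ?_)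
  have hBz : |v (z.1, -z.2)| ≤ B (z.1, -z.2) := hvB _
  have hB0 : 0 ≤ B (z.1, -z.2) := (abs_nonneg _).trans hBz
  simp only [Real.norm_eq_abs, Pi.mul_apply, Function.comp_apply, Pi.neg_apply, abs_mul, abs_of_pos (hρpos z),
    abs_of_nonneg hB0]
  exact mul_le_mul_of_nonneg_right hBz (hρpos z).le

/-! ### Hörmander's theorem: the weak solution has a smooth Lebesgue density -/

/-- **Hypoelliptic regularity of the weak Poisson solution.** If `v` is `μ`-measurable with `|v| ≤ B` (`B`
continuous) and `∫ (Lφ)(v∘Θ) dμ = -∫ φ f dμ` for all test functions `φ`, with `f` smooth, then `(v∘Θ)ρ = g`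
Lebesgue-a.e. for a smooth `g` (Hörmander's Theorem 1.1 for `P* = ∑_b X_b² - Y + 2γ`, `ᵗ(P*) = L` on test functions,
applied to the distribution `(v∘Θ)ρ dz`, whose `P*`-image is the smooth function `-fρ`).
[cite: Hormander1967, Thm 1.1] -/
theorem exists_contDiff_ae_eq_of_weak (hω : 0 < ω₂) (hl : 0 ≤ lam) (hβ : 0 ≤ β) (hγ : 0 < γ) (hT : 0 < T)
    (hN : 0 < N) {f v B : PhaseSpace N → ℝ} (hf : ContDiff ℝ ∞ f) (hB : Continuous B) (hvB : ∀ z, |v z| ≤ B z)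
    (hv : AEStronglyMeasurable v ((pinnedChain ω₂ lam β γ).gibbsMeasure N T))
    (hweak : ∀ φ : PhaseSpace N → ℝ, ContDiff ℝ ∞ φ → HasCompactSupport φ →
      ∫ z, (pinnedChain ω₂ lam β γ).generator N T T φ z * v (z.1, -z.2) ∂((pinnedChain ω₂ lam β γ).gibbsMeasure N T) =
        -∫ z, φ z * f z ∂((pinnedChain ω₂ lam β γ).gibbsMeasure N T)) :
    ∃ g : PhaseSpace N → ℝ, ContDiff ℝ ∞ g ∧
      ∀ᵐ z ∂(volume : Measure (PhaseSpace N)), v (z.1, -z.2) * (pinnedChain ω₂ lam β γ).gibbsDensity N T z = g z := by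
  haveI := isAddHaarMeasure_volume_phaseSpace N
  have hU : ContDiff ℝ ∞ (pinnedChain ω₂ lam β γ).U := pinnedChain_contDiff_U ω₂ lam β γ
  have hV : ContDiff ℝ ∞ (pinnedChain ω₂ lam β γ).V := pinnedChain_contDiff_V ω₂ lam β γ
  have hγ' : (pinnedChain ω₂ lam β γ).γ = γ := rfl
  have hγT : 0 < (pinnedChain ω₂ lam β γ).γ * T := by rw [hγ']; positivity
  have hρsmooth := contDiff_gibbsDensity ω₂ lam β γ N T
  have hρint : Integrable ((pinnedChain ω₂ lam β γ).gibbsDensity N T) :=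
    pinnedChain_integrable_gibbsDensity hω hl hβ γ N hT
  have hZ : 0 < ∫ x, (pinnedChain ω₂ lam β γ).gibbsDensity N T x := integral_exp_pos hρint
  obtain ⟨-, hh_loc⟩ := locallyIntegrable_rev_mul_gibbsDensity (γ := γ) hω hl hβ hT hB hvB hv
  -- the distribution `(v∘Θ)ρ dz` on the whole phase space
  let Td : 𝓓'((⊤ : Opens (PhaseSpace N)), ℝ) :=
    (TestFunction.integralAgainstBilinCLM (ContinuousLinearMap.mul ℝ ℝ) (volume : Measure (PhaseSpace N))
      (fun z : PhaseSpace N => v (z.1, -z.2) * (pinnedChain ω₂ lam β γ).gibbsDensity N T z) :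
      𝓓((⊤ : Opens (PhaseSpace N)), ℝ) →L[ℝ] ℝ)
  have hTd : ∀ φ : 𝓓((⊤ : Opens (PhaseSpace N)), ℝ),
      Td φ = ∫ x, φ x * (v (x.1, -x.2) * (pinnedChain ω₂ lam β γ).gibbsDensity N T x) := by
    intro φ
    change TestFunction.integralAgainstBilinCLM (ContinuousLinearMap.mul ℝ ℝ) (volume : Measure (PhaseSpace N))
      (fun z : PhaseSpace N => v (z.1, -z.2) * (pinnedChain ω₂ lam β γ).gibbsDensity N T z) φ = _
    rw [TestFunction.integralAgainstBilinCLM_eq_integral (hh_loc.locallyIntegrableOn _)]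
    simp
  -- Hörmander's theorem for `P*`
  have hbr : IsBracketGenerating (fun o : Option (Fin 2) =>
      o.elim ((pinnedChain ω₂ lam β γ).adjointDrift N) ((pinnedChain ω₂ lam β γ).bathField hN T T)) univ :=
    (pinnedChain ω₂ lam β γ).isBracketGenerating_hormanderFamily hN T T hU hV hγT fun r => by
      rw [pinnedChain_deriv_deriv_V]; positivity
  have hyp := Literature.Analysis.Hypoelliptic.hormander1967_thm11_proof (PhaseSpace N)
    (volume : Measure (PhaseSpace N)) (Fin 2) ⊤ ((pinnedChain ω₂ lam β γ).adjointDrift N)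
    ((pinnedChain ω₂ lam β γ).bathField hN T T) (fun _ => 2 * (pinnedChain ω₂ lam β γ).γ)
    ((pinnedChain ω₂ lam β γ).contDiff_adjointDrift hU hV N) (fun _ => contDiff_const) contDiff_const
    (by simpa using hbr)
  -- the image of the distribution under `P*` is the smooth function `-fρ`
  have himg : Literature.Analysis.Distribution.ImageIsSmoothOn Td
      (hormanderTranspose ((pinnedChain ω₂ lam β γ).adjointDrift N) ((pinnedChain ω₂ lam β γ).bathField hN T T)
        (fun _ => 2 * (pinnedChain ω₂ lam β γ).γ)) (volume : Measure (PhaseSpace N)) univ := by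
    refine ⟨fun z => -f z * (pinnedChain ω₂ lam β γ).gibbsDensity N T z, (hf.neg.mul hρsmooth).contDiffOn,
      fun φ ψ _ hψ => ?_⟩
    rw [hTd]
    have eψ : (ψ : PhaseSpace N → ℝ) = (pinnedChain ω₂ lam β γ).generator N T T φ := by
      rw [hψ, (pinnedChain ω₂ lam β γ).hormanderTranspose_eq_generator hU hV hN hγT.le hγT.le φ.contDiff]
    rw [eψ]
    have key := hweak φ φ.contDiff φ.hasCompactSupport
    rw [(pinnedChain ω₂ lam β γ).integral_gibbsMeasure, (pinnedChain ω₂ lam β γ).integral_gibbsMeasure,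
      ← mul_neg] at key
    have key' := mul_left_cancel₀ (inv_ne_zero hZ.ne') key
    calc ∫ x, (pinnedChain ω₂ lam β γ).generator N T T φ x *
          (v (x.1, -x.2) * (pinnedChain ω₂ lam β γ).gibbsDensity N T x)
        = ∫ x, (pinnedChain ω₂ lam β γ).generator N T T φ x * v (x.1, -x.2) *
            (pinnedChain ω₂ lam β γ).gibbsDensity N T x :=
          integral_congr_ae (Eventually.of_forall fun x => (mul_assoc _ _ _).symm)
      _ = -∫ x, φ x * f x * (pinnedChain ω₂ lam β γ).gibbsDensity N T x := key'
      _ = ∫ x, -f x * (pinnedChain ω₂ lam β γ).gibbsDensity N T x * φ x := by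
          rw [← integral_neg]
          exact integral_congr_ae (Eventually.of_forall fun x => by simp only; ring)
  obtain ⟨g, hg, hgint⟩ := hyp Td univ isOpen_univ (subset_univ _) himg
  rw [contDiffOn_univ] at hg
  refine ⟨g, hg, ?_⟩
  refine ae_eq_of_integral_contDiff_smul_eq hh_loc hg.continuous.locallyIntegrable fun φ hφ hφc => ?_
  let ψ : 𝓓((⊤ : Opens (PhaseSpace N)), ℝ) := ⟨φ, hφ, hφc, fun _ _ => trivial⟩
  have e1 := hgint ψ (subset_univ _)
  rw [hTd] at e1
  simp only [smul_eq_mul]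
  calc ∫ x, φ x * (v (x.1, -x.2) * (pinnedChain ω₂ lam β γ).gibbsDensity N T x) = ∫ x, g x * φ x := e1
    _ = ∫ x, φ x * g x := integral_congr_ae (Eventually.of_forall fun x => mul_comm _ _)

/-! ### From the weak equation to the pointwise one for a smooth representative -/

/-- **Weak ⇒ pointwise for a smooth representative.** If `w` is smooth, `w∘Θ = v∘Θ` `μ`-a.e., and
`∫ (Lφ)(v∘Θ) dμ = -∫ φ f dμ` for all test functions (`f` continuous), then `(L w)(Θz) = -f z` for every `z`
(`∫ (Lφ)(w∘Θ) dμ = ∫ φ (Lw)∘Θ dμ` by the reversal adjoint identity, the fundamental lemma of the calculus of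
variations, continuity and positivity of `ρ`). [cite: KunduDharNarayan2009, eq. (reln2)] -/
theorem generator_rev_eq_of_weak (hω : 0 < ω₂) (hl : 0 ≤ lam) (hβ : 0 ≤ β) (hT : 0 < T)
    {f v w : PhaseSpace N → ℝ} (hf : Continuous f) (hw : ContDiff ℝ ∞ w)
    (hwv : ∀ᵐ z ∂((pinnedChain ω₂ lam β γ).gibbsMeasure N T), w (z.1, -z.2) = v (z.1, -z.2))
    (hweak : ∀ φ : PhaseSpace N → ℝ, ContDiff ℝ ∞ φ → HasCompactSupport φ →
      ∫ z, (pinnedChain ω₂ lam β γ).generator N T T φ z * v (z.1, -z.2) ∂((pinnedChain ω₂ lam β γ).gibbsMeasure N T) =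
        -∫ z, φ z * f z ∂((pinnedChain ω₂ lam β γ).gibbsMeasure N T)) (z : PhaseSpace N) :
    (pinnedChain ω₂ lam β γ).generator N T T w (z.1, -z.2) = -f z := by
  haveI := isAddHaarMeasure_volume_phaseSpace N
  haveI := pinnedChain_isProbabilityMeasure_gibbsMeasure hω hl hβ γ N hT
  have hU1 : ContDiff ℝ 1 (pinnedChain ω₂ lam β γ).U := pinnedChain_contDiff_U ω₂ lam β γ
  have hV1 : ContDiff ℝ 1 (pinnedChain ω₂ lam β γ).V := pinnedChain_contDiff_V ω₂ lam β γ
  have hρc : Continuous ((pinnedChain ω₂ lam β γ).gibbsDensity N T) :=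
    pinnedChain_continuous_gibbsDensity ω₂ lam β γ N T
  have hρpos : ∀ z, 0 < (pinnedChain ω₂ lam β γ).gibbsDensity N T z := fun z =>
    (pinnedChain ω₂ lam β γ).gibbsDensity_pos N T z
  have hρint : Integrable ((pinnedChain ω₂ lam β γ).gibbsDensity N T) :=
    pinnedChain_integrable_gibbsDensity hω hl hβ γ N hT
  have hZ : 0 < ∫ x, (pinnedChain ω₂ lam β γ).gibbsDensity N T x := integral_exp_pos hρint
  have hΘc : Continuous fun z : PhaseSpace N => ((z.1, -z.2) : PhaseSpace N) :=
    continuous_fst.prodMk continuous_snd.neg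
  have hΘsmooth : ContDiff ℝ ∞ fun z : PhaseSpace N => ((z.1, -z.2) : PhaseSpace N) :=
    contDiff_fst.prodMk contDiff_snd.neg
  have hLw : Continuous ((pinnedChain ω₂ lam β γ).generator N T T w) :=
    (pinnedChain ω₂ lam β γ).continuous_generator hU1 hV1 N T T (hw.of_le (by norm_cast))
  -- `F := (Lw)∘Θ + f` is continuous and orthogonal (with the weight `ρ`) to all test functions
  set F : PhaseSpace N → ℝ := fun z => (pinnedChain ω₂ lam β γ).generator N T T w (z.1, -z.2) + f z with hF
  have hFc : Continuous F := (hLw.comp hΘc).add hf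
  have horth : ∀ φ : PhaseSpace N → ℝ, ContDiff ℝ ∞ φ → HasCompactSupport φ →
      ∫ x, φ x • (F x * (pinnedChain ω₂ lam β γ).gibbsDensity N T x) = 0 := by
    intro φ hφ hφc
    have hφ2 : ContDiff ℝ 2 φ := hφ.of_le (by norm_cast)
    have hw2 : ContDiff ℝ 2 (fun y : PhaseSpace N => w (y.1, -y.2)) := (hw.comp hΘsmooth).of_le (by norm_cast)
    have hrev := Summit.AtomisticToContinuum.FouriersLaw.Theorems.OddSectorIrreversibility.pinnedChain_integral_generator_mul_gibbsMeasure_eq_reversal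
      ω₂ lam β γ N hT.ne' hφ2 hφc hw2
    have eww : (fun y : PhaseSpace N => (fun y : PhaseSpace N => w (y.1, -y.2)) (y.1, -y.2)) = w := by
      funext y; simp
    rw [eww] at hrev
    have hl' : ∫ x, (pinnedChain ω₂ lam β γ).generator N T T φ x * w (x.1, -x.2)
        ∂((pinnedChain ω₂ lam β γ).gibbsMeasure N T) =
        ∫ x, (pinnedChain ω₂ lam β γ).generator N T T φ x * v (x.1, -x.2)
          ∂((pinnedChain ω₂ lam β γ).gibbsMeasure N T) := by
      refine integral_congr_ae ?_
      filter_upwards [hwv] with x hx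
      rw [hx]
    rw [hl', hweak φ hφ hφc] at hrev
    have i1 : Integrable (fun x => φ x * f x) ((pinnedChain ω₂ lam β γ).gibbsMeasure N T) :=
      (hφ.continuous.mul hf).integrable_of_hasCompactSupport hφc.mul_right
    have i2 : Integrable (fun x => φ x * (pinnedChain ω₂ lam β γ).generator N T T w (x.1, -x.2))
        ((pinnedChain ω₂ lam β γ).gibbsMeasure N T) :=
      (hφ.continuous.mul (hLw.comp hΘc)).integrable_of_hasCompactSupport hφc.mul_right
    have hsum : ∫ x, φ x * F x ∂((pinnedChain ω₂ lam β γ).gibbsMeasure N T) = 0 := by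
      simp only [hF, mul_add]
      rw [integral_add i2 i1]
      linarith
    rw [(pinnedChain ω₂ lam β γ).integral_gibbsMeasure] at hsum
    have h0 := (mul_eq_zero.1 hsum).resolve_left (inv_ne_zero hZ.ne')
    simpa only [smul_eq_mul, mul_assoc] using h0
  have hFρ : ∀ᵐ x ∂(volume : Measure (PhaseSpace N)), F x * (pinnedChain ω₂ lam β γ).gibbsDensity N T x = 0 :=
    ae_eq_zero_of_integral_contDiff_smul_eq_zero (hFc.mul hρc).locallyIntegrable horth
  have hFz := eq_zero_of_ae (hFc.mul hρc) hFρ z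
  have hFz' : F z = 0 := (mul_eq_zero.1 hFz).resolve_right (hρpos z).ne'
  simp only [hF] at hFz'
  linarith

/-! ### Assembly -/

/-- **The smooth modification of the weak Poisson solution** (abstract form of stub F1b): for `f` smooth and even in
the momenta, `B` continuous, `v` `μ`-measurable with `|v| ≤ B` and `∫ (Lφ)(v∘Θ) dμ = -∫ φ f dμ` for all test `φ`,
there is a smooth `w` with `w = v` `μ`-a.e., `|w| ≤ B` and `L w = -f` pointwise.
[cite: Hormander1967, Thm 1.1] -/
theorem exists_smooth_modification (hω : 0 < ω₂) (hl : 0 ≤ lam) (hβ : 0 ≤ β) (hγ : 0 < γ) (hT : 0 < T)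
    (hN : 0 < N) {f v B : PhaseSpace N → ℝ} (hf : ContDiff ℝ ∞ f) (hfeven : ∀ z : PhaseSpace N, f (z.1, -z.2) = f z)
    (hB : Continuous B) (hvB : ∀ z, |v z| ≤ B z)
    (hv : AEStronglyMeasurable v ((pinnedChain ω₂ lam β γ).gibbsMeasure N T))
    (hweak : ∀ φ : PhaseSpace N → ℝ, ContDiff ℝ ∞ φ → HasCompactSupport φ →
      ∫ z, (pinnedChain ω₂ lam β γ).generator N T T φ z * v (z.1, -z.2) ∂((pinnedChain ω₂ lam β γ).gibbsMeasure N T) =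
        -∫ z, φ z * f z ∂((pinnedChain ω₂ lam β γ).gibbsMeasure N T)) :
    ∃ w : PhaseSpace N → ℝ, ContDiff ℝ ∞ w ∧ (∀ᵐ z ∂((pinnedChain ω₂ lam β γ).gibbsMeasure N T), w z = v z) ∧
      (∀ z, |w z| ≤ B z) ∧ ∀ z, (pinnedChain ω₂ lam β γ).generator N T T w z = -f z := by
  have hρpos : ∀ z, 0 < (pinnedChain ω₂ lam β γ).gibbsDensity N T z := fun z =>
    (pinnedChain ω₂ lam β γ).gibbsDensity_pos N T z
  have hρsmooth := contDiff_gibbsDensity ω₂ lam β γ N T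
  have hΘ := measurePreserving_momentumReversal N
  have hΘsmooth : ContDiff ℝ ∞ fun z : PhaseSpace N => ((z.1, -z.2) : PhaseSpace N) :=
    contDiff_fst.prodMk contDiff_snd.neg
  have hac := (pinnedChain ω₂ lam β γ).gibbsMeasure_absolutelyContinuous N T
  obtain ⟨g, hg, hae⟩ := exists_contDiff_ae_eq_of_weak hω hl hβ hγ hT hN hf hB hvB hv hweak
  -- the modification `w := (g∘Θ)/ρ`
  have hwsmooth : ContDiff ℝ ∞ fun z : PhaseSpace N => g (z.1, -z.2) / (pinnedChain ω₂ lam β γ).gibbsDensity N T z :=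
    (hg.comp hΘsmooth).div hρsmooth fun z => (hρpos z).ne'
  -- `v∘Θ = w∘Θ` Lebesgue-a.e., then `v = w` by transport under `Θ`
  have hae1 : ∀ᵐ z ∂(volume : Measure (PhaseSpace N)), v (z.1, -z.2) =
      (fun z : PhaseSpace N => g (z.1, -z.2) / (pinnedChain ω₂ lam β γ).gibbsDensity N T z) (z.1, -z.2) := by
    filter_upwards [hae] with z hz
    simp only [neg_neg, Prod.mk.eta]
    rw [gibbsDensity_rev, eq_div_iff (hρpos z).ne']
    exact hz
  have hae2 : ∀ᵐ z ∂(volume : Measure (PhaseSpace N)),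
      v z = g (z.1, -z.2) / (pinnedChain ω₂ lam β γ).gibbsDensity N T z := by
    have h2 := hΘ.quasiMeasurePreserving.ae hae1
    filter_upwards [h2] with z hz
    simpa using hz
  refine ⟨fun z => g (z.1, -z.2) / (pinnedChain ω₂ lam β γ).gibbsDensity N T z, hwsmooth, ?_, ?_, fun z => ?_⟩
  · exact hac.ae_le (hae2.mono fun z hz => hz.symm)
  · refine OddSectorIrreversibility.Corrector.le_of_ae_le_of_continuous hwsmooth.continuous.abs hB ?_
    filter_upwards [hae2] with z hz
    rw [← hz]
    exact hvB z
  · have h1 := generator_rev_eq_of_weak (γ := γ) hω hl hβ hT hf.continuous hwsmooth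
      (hac.ae_le (hae1.mono fun z hz => hz.symm)) hweak (z.1, -z.2)
    simp only [neg_neg, Prod.mk.eta] at h1
    rw [h1, hfeven]

end Pinned

end OrthogonalOhmLine.PoissonSmooth

open OrthogonalOhmLine.PoissonSmooth in
/-- **Stub F1b** (`PoissonSmooth`, line `Sketch`, skeleton v5 of crux `stmt-AtomisticToContinuum-12693`): a measurable,
admissibly bounded weak solution `v` of the Poisson equation of the energy profile `u = ∑ ξ_x e_x` (time-reversed weak
form) has a smooth modification `w` solving `L w = -(u - m)` POINTWISE with the same bound `A e^{H/(8T)}`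
(Hörmander's theorem for the Fokker–Planck operator, the reversal adjoint identity and the fundamental lemma).
[cite: Hormander1967, Thm 1.1] -/
theorem stub_poissonSmooth :
    ∀ ω₂ lam β γ : ℝ, 0 < ω₂ → 0 < lam → 0 < β → 0 < γ → ∀ T : ℝ, 0 < T → ∀ N : ℕ, 2 ≤ N → ∀ ξ : Fin N → ℝ, let P := Literature.MathematicalPhysics.KineticTheory.HeatConduction.pinnedChain ω₂ lam β γ; let X := Literature.MathematicalPhysics.KineticTheory.HeatConduction.PhaseSpace N; let μ : MeasureTheory.Measure X := P.gibbsMeasure N T; let e : Fin N → X → ℝ := fun x z => z.2 x ^ 2 / 2 + P.U (z.1 x) + ∑ j : Fin N, ((if j.val = x.val + 1 then P.V (z.1 j - z.1 x) / 2 else 0) + (if x.val = j.val + 1 then P.V (z.1 x - z.1 j) / 2 else 0)); let u : X → ℝ := fun z => ∑ x : Fin N, ξ x * e x z; let m : ℝ := ∫ z, u z ∂μ; let v : X → ℝ := fun z => ∫ t in Set.Ioi (0 : ℝ), ((∫ y, u y ∂(P.transitionKernel N T T t.toNNReal z)) - m);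
      (∃ A : ℝ, ∀ z, |v z| ≤ A * Real.exp (P.hamiltonian N z / (8 * T))) →
      MeasureTheory.AEStronglyMeasurable v μ →
      (∀ φ : X → ℝ, ContDiff ℝ ∞ φ → HasCompactSupport φ →
        ∫ z, P.generator N T T φ z * v (z.1, -z.2) ∂μ = -∫ z, φ z * (u z - m) ∂μ) →
      ∃ w : X → ℝ, ContDiff ℝ ∞ w ∧ (∀ᵐ z ∂μ, w z = v z) ∧
        (∃ A : ℝ, ∀ z, |w z| ≤ A * Real.exp (P.hamiltonian N z / (8 * T))) ∧
        ∀ z, P.generator N T T w z = -(u z - m) := by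
  intro ω₂ lam β γ hω hl hβ hγ T hT N hN ξ P X μ e u m v hA hmeas hweak
  obtain ⟨A, hA⟩ := hA
  have hN0 : 0 < N := by omega
  have hes : ∀ x, ContDiff ℝ ∞ (e x) := fun x =>
    OrthogonalOhmLine.G0PosDef.contDiff_splitSite (ω₂ := ω₂) (lam := lam) (β := β) (γ := γ) (e := e)
      (fun _ _ => rfl) x
  have herev : ∀ x (z : X), e x (z.1, -z.2) = e x z := fun x =>
    (pinnedChain_splitSite_nice (ω₂ := ω₂) (lam := lam) (β := β) (γ := γ) (N := N) e (fun _ _ => rfl)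
      hω hl.le hβ.le x).2.1
  have hu : ContDiff ℝ ∞ u := by
    change ContDiff ℝ ∞ fun z : X => ∑ x : Fin N, ξ x * e x z
    exact ContDiff.sum fun x _ => contDiff_const.mul (hes x)
  have hue : ∀ z : X, u (z.1, -z.2) = u z := fun z => by
    change (∑ x : Fin N, ξ x * e x (z.1, -z.2)) = ∑ x : Fin N, ξ x * e x z
    exact Finset.sum_congr rfl fun x _ => by rw [herev]
  have hBc : Continuous fun z : X => |A| * Real.exp (P.hamiltonian N z / (8 * T)) :=
    continuous_const.mul (Real.continuous_exp.comp
      ((pinnedChain_contDiff_hamiltonian ω₂ lam β γ N (n := 0)).continuous.div_const _))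
  have hvB : ∀ z : X, |v z| ≤ |A| * Real.exp (P.hamiltonian N z / (8 * T)) := fun z =>
    (hA z).trans (mul_le_mul_of_nonneg_right (le_abs_self A) (Real.exp_pos _).le)
  obtain ⟨w, hw, hwv, hwB, hLw⟩ := exists_smooth_modification (ω₂ := ω₂) (lam := lam) (β := β) (γ := γ)
    (T := T) hω hl.le hβ.le hγ hT hN0 (f := fun z => u z - m) (v := v)
    (B := fun z => |A| * Real.exp (P.hamiltonian N z / (8 * T)))
    (hu.sub contDiff_const) (fun z => by simp only [hue z]) hBc hvB hmeas hweak
  exact ⟨w, hw, hwv, ⟨|A|, hwB⟩, hLw⟩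

end Summit.AtomisticToContinuum.FouriersLaw.Theorems.HonestZwanzig
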